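import Literature.Analysis.FluidPDE.Tao2016AveragedNS.SplitCascadeInvariant
import Literature.Analysis.FluidPDE.TaoCascadeRescaledStepOrder
import HarnessLib

/-!
# Tao's cascade ODE with the squared modes doubled, VII: the rescaling of §6.4 for the split system
# — rescaled hypotheses with asymmetry rows and profile clauses, and "Prop 6.4♯ ⇐ Prop 6.5♯"

T. Tao, *Finite time blowup for an averaged three-dimensional Navier–Stokes equation*, J. Amer.
Math. Soc. **29** (2016) 601–674 = arXiv:1402.0290v3, §6.4: Proposition 6.5 ((6.43)–(6.81)), the
rescaling (6.82)–(6.84) and the paragraph "Let us now explain why Proposition 6.5 implies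
Proposition 6.4" [`Tao2016AveragedNS`]. Split companion of the tree's `TaoCascadeRescaled.lean`
(`RescaledHypotheses`, `RescaledConclusion`) and `TaoCascadeRescaledStepOrder.lean`
(`TaoODESystem.rescaledHypotheses`, `StateBoundsWith.unscale`, `StepBounds.unscale`,
`blowupDynamicsStepWith_of_rescaledStepWith'`), whose rescaling maps `rescScale`, `rescTime`,
`rescMode`, `rescEnergy`, `tauConst` are reused verbatim.

HONEST FRAMING (cell harvest/h2-tao-ladder, rung 1 of a ladder of MODEL equations; RUNG1-HANDOFF h4 /
R1-b): this file brings the split reduction chain to the level at which the tree actually proves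
Tao's Theorem 6.2 — the RESCALED inductive step. `RescaledSplitHypotheses` = Tao's (6.43)–(6.66) for
the symmetric amplitudes with the `symCorrection` terms in (6.45)–(6.48), the two-way fluxes in
(6.49), `½ΣZ²` in (6.51), the rescaled asymmetry rows (6.Z1)–(6.Z3), and the profile clauses of
`SplitAsymmetryProfile η β` at the checkpoint (`|Z_{i,m}(0)| ≤ η(m)`, `|Z_{i,-1}(0)| ≤ η(-1)`,
`b_m(0) ≥ -β(m)`); `SplitODESystem.rescaledSplitHypotheses` PROVES that a split solution with
checkpoints `BlowupCheckpointsWith γ` and profile `SplitAsymmetryProfile η β` at level `N` rescales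
into them (port of the tree's proof; the `Z`-rows rescale like the `X`-rows since every term is
quadratic); `RescaledSplitConclusion` adds the profile at the new checkpoint; and
`splitBlowupDynamicsStepWith_of_rescaledSplitStepWith` / `noGlobalSplit_of_rescaledSplitStepWith`
PROVE Prop 6.4♯_γ(P♯) ⇐ Prop 6.5♯_γ(η,β) and hence Theorem 6.2♯ ⇐ Prop 6.5♯_γ(η,β). The rescaled
step itself (`rescaledSplitStepWith γ η β`, a predicate, NOT asserted) is the cell's open obligation
in the tree's own vocabulary; nothing here concerns Navier–Stokes.
-/

noncomputable section

open Set MeasureTheory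

namespace Literature.Analysis.FluidPDE.Tao2016AveragedNS

open TaoCascade

/-! ## The rescaled asymmetries -/

/-- The rescaled asymmetries `Z̃_{i,k}(s) := e_N⁻¹ Z_{i,N+k}(t_N + (1+ε₀)^{-5N/2} e_N⁻¹ s)` (the
`rescMode` of the asymmetry block). [cite: Tao2016AveragedNS, §6.4 after (6.83)] -/
def rescModeZ (ε₀ : ℝ) (t e : ℤ → ℝ) (N : ℤ) (Z : Fin 3 → ℤ → ℝ → ℝ) : Fin 3 → ℤ → ℝ → ℝ :=
  fun i k s => (e N)⁻¹ * Z i (N + k) (t N + rescScale ε₀ e N * s)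

/-! ## Hypotheses (i)–(ix) of Proposition 6.5 for the split system, with the profile clauses -/

/-- **The hypotheses of the split Proposition 6.5** (parameters as in `TaoCascade.RescaledHypotheses`,
plus the asymmetries `W = (Z̃_a, Z̃_c, Z̃_d)` and the profiles `η : ℤ → ℝ`, `β : ℕ → ℝ`): Tao's
(6.43)–(6.66) for the symmetric amplitudes `Y = (ã, b̃, c̃, d̃)` and energies `F`, with (6.45)–(6.48)
corrected by `symCorrection`, (6.49) with the two-way fluxes, (6.51) with `½ΣZ̃²`; the rescaled
asymmetry rows (6.Z1)–(6.Z3) with the same error class; regularity / a priori / initial / cut-off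
clauses for `W`; and the profile clauses at the checkpoint: `|W_{i,m}(0)| ≤ η(m)` (`m ≥ 0`),
`|W_{i,-1}(0)| ≤ η(-1)` if `N > n₀`, `b̃_m(0) ≥ -β(m)` (`m ≥ 1`).
[cite: Tao2016AveragedNS, §6.4 Prop. 6.5 (6.43)–(6.66)] -/
structure RescaledSplitHypotheses (γ ε₀ K ε C₁ C₂ C₃ : ℝ) (n₀ N : ℤ) (η : ℤ → ℝ) (β : ℕ → ℝ)
    (τ : ℤ → ℝ) (Y : Fin 4 → ℤ → ℝ → ℝ) (W : Fin 3 → ℤ → ℝ → ℝ) (F : ℤ → ℝ → ℝ) : Prop where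
  /-- `τ₀ = 0`. -/
  tau_zero : τ 0 = 0
  /-- `τ_{n₀-N} < … < τ₀`: consecutive rescaled times increase. -/
  tau_lt : ∀ k, n₀ - N < k → k ≤ 0 → τ (k - 1) < τ k
  /-- `a_k, b_k, c_k, d_k` are continuously differentiable on `[τ_{n₀-N}, +∞)`. -/
  contDiffOn_Y : ∀ i k, ContDiffOn ℝ 1 (Y i k) (Ici (τ (n₀ - N)))
  /-- `Ẽ_k` is continuously differentiable on `[τ_{n₀-N}, +∞)`. -/
  contDiffOn_F : ∀ k, ContDiffOn ℝ 1 (F k) (Ici (τ (n₀ - N)))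
  /-- `Ẽ_k` takes values in `[0, +∞)`. -/
  nonneg_F : ∀ k t, τ (n₀ - N) ≤ t → 0 ≤ F k t
  /-- (6.43): a priori regularity of the modes. -/
  apriori_Y : ∀ T : ℝ, τ (n₀ - N) < T → ∃ M : ℝ, ∀ t ∈ Icc (τ (n₀ - N)) T, ∀ k : ℤ,
    (1 + (1 + ε₀) ^ ((10 : ℝ) * k)) * (|Y 0 k t| + |Y 1 k t| + |Y 2 k t| + |Y 3 k t|) ≤ M
  /-- (6.44): a priori regularity of the energies. -/
  apriori_F : ∀ T : ℝ, τ (n₀ - N) < T → ∃ M : ℝ, ∀ t ∈ Icc (τ (n₀ - N)) T, ∀ k : ℤ,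
    (1 + (1 + ε₀) ^ ((10 : ℝ) * k)) * Real.sqrt (F k t) ≤ M
  /-- (6.45♯): equation of motion of the symmetric `a_k`, with the corrections `+ε⁻²Z_cZ_d - KZ_{d,k-1}²`. -/
  eq1 : ∀ k t, τ (n₀ - N) ≤ t →
    |derivWithin (Y 0 k) (Ici (τ (n₀ - N))) t - (1 + ε₀) ^ ((5 : ℝ) * k / 2) *
        (-(ε ^ 2)⁻¹ * Y 2 k t * Y 3 k t - ε * Y 0 k t * Y 1 k t -
          ε ^ 2 * Real.exp (-K ^ 10) * Y 0 k t * Y 2 k t + K * Y 3 (k - 1) t ^ 2 +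
          (ε ^ 2)⁻¹ * W 1 k t * W 2 k t - K * W 2 (k - 1) t ^ 2)| ≤
      C₁ * (1 + ε₀) ^ ((2 : ℝ) * k - n₀ / 2) * Real.sqrt (F k t)
  /-- (6.46♯): equation of motion of `b_k`, with `-εZ_a² + ε⁻¹K¹⁰Z_c²`. -/
  eq2 : ∀ k t, τ (n₀ - N) ≤ t →
    |derivWithin (Y 1 k) (Ici (τ (n₀ - N))) t - (1 + ε₀) ^ ((5 : ℝ) * k / 2) *
        (ε * Y 0 k t ^ 2 - ε⁻¹ * K ^ 10 * Y 2 k t ^ 2 - ε * W 0 k t ^ 2 +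
          ε⁻¹ * K ^ 10 * W 1 k t ^ 2)| ≤
      C₁ * (1 + ε₀) ^ ((2 : ℝ) * k - n₀ / 2) * Real.sqrt (F k t)
  /-- (6.47♯): equation of motion of the symmetric `c_k`, with `-ε²e^{-K¹⁰}Z_a²`. -/
  eq3 : ∀ k t, τ (n₀ - N) ≤ t →
    |derivWithin (Y 2 k) (Ici (τ (n₀ - N))) t - (1 + ε₀) ^ ((5 : ℝ) * k / 2) *
        (ε ^ 2 * Real.exp (-K ^ 10) * Y 0 k t ^ 2 + ε⁻¹ * K ^ 10 * Y 1 k t * Y 2 k t -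
          ε ^ 2 * Real.exp (-K ^ 10) * W 0 k t ^ 2)| ≤
      C₁ * (1 + ε₀) ^ ((2 : ℝ) * k - n₀ / 2) * Real.sqrt (F k t)
  /-- (6.48♯): equation of motion of the symmetric `d_k`, with `-ε⁻²Z_aZ_c`. -/
  eq4 : ∀ k t, τ (n₀ - N) ≤ t →
    |derivWithin (Y 3 k) (Ici (τ (n₀ - N))) t - (1 + ε₀) ^ ((5 : ℝ) * k / 2) *
        ((ε ^ 2)⁻¹ * Y 2 k t * Y 0 k t -
          (1 + ε₀) ^ ((5 : ℝ) / 2) * K * Y 3 k t * Y 0 (k + 1) t -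
          (ε ^ 2)⁻¹ * W 0 k t * W 1 k t)| ≤
      C₁ * (1 + ε₀) ^ ((2 : ℝ) * k - n₀ / 2) * Real.sqrt (F k t)
  /-- (6.49♯): the local energy inequality with the two-way hand-off fluxes `K(d² - Z_d²)a`. -/
  energy : ∀ k t, τ (n₀ - N) ≤ t →
    derivWithin (F k) (Ici (τ (n₀ - N))) t ≤
      K * (1 + ε₀) ^ ((5 : ℝ) * k / 2) *
        ((Y 3 (k - 1) t ^ 2 - W 2 (k - 1) t ^ 2) * Y 0 k t -
          (1 + ε₀) ^ ((5 : ℝ) / 2) * (Y 3 k t ^ 2 - W 2 k t ^ 2) * Y 0 (k + 1) t)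
  /-- (6.50): initial conditions, modes: `a_k(τ_{n₀-N}) = … = d_k(τ_{n₀-N}) = 0` for `k > n₀-N`. -/
  init_Y : ∀ i k, n₀ - N < k → Y i k (τ (n₀ - N)) = 0
  /-- (6.50): initial conditions, energies: `Ẽ_k(τ_{n₀-N}) = 0` for `k > n₀-N`. -/
  init_F : ∀ k, n₀ - N < k → F k (τ (n₀ - N)) = 0
  /-- (6.51), lower bound: `½(a_k²+b_k²+c_k²+d_k²) ≤ Ẽ_k`. -/
  defect_lower : ∀ k t, τ (n₀ - N) ≤ t → (1 / 2) * (∑ i, Y i k t ^ 2 + ∑ i, W i k t ^ 2) ≤ F k t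
  /-- (6.51), upper bound, with implied constant `C₂`. -/
  defect_upper : ∀ k t, τ (n₀ - N) ≤ t →
    F k t ≤ (1 / 2) * (∑ i, Y i k t ^ 2 + ∑ i, W i k t ^ 2) +
      C₂ * (1 + ε₀) ^ ((2 : ℝ) * k - n₀ / 2) * ∫ s in (τ (n₀ - N))..t, F k s
  /-- (6.52): no very low frequencies, modes. -/
  noLow_Y : ∀ i k t, k < n₀ - N → τ (n₀ - N) ≤ t → Y i k t = 0
  /-- (6.52): no very low frequencies, energies. -/
  noLow_F : ∀ k t, k < n₀ - N → τ (n₀ - N) ≤ t → F k t = 0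
  /-- (6.53), lower bound, with implied constant `C₃`: `-C₃ (1+ε₀)^{(5/2+1/100)|k|} ≤ τ_k`. -/
  tau_ge : ∀ k, n₀ - N ≤ k → k ≤ 0 →
    -(C₃ * (1 + ε₀) ^ (((5 : ℝ) / 2 + 1 / 100) * |(k : ℝ)|)) ≤ τ k
  /-- (6.53), upper bound: `τ_k ≤ 0`. -/
  tau_le : ∀ k, n₀ - N ≤ k → k ≤ 0 → τ k ≤ 0
  /-- (6.54) `a₀(0) = 1`. -/
  a_eq : Y 0 0 0 = 1
  /-- (6.55) `|b₀(0)| ≤ 10⁻⁵ ε`. -/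
  b_abs_le : |Y 1 0 0| ≤ 1 / 10 ^ 5 * ε
  /-- (6.56)_γ `|c₀(0)| ≤ γ ε²` (printed: `γ = 10⁻⁵ exp(-K¹⁰)`). -/
  c_abs_le : |Y 2 0 0| ≤ γ * ε ^ 2
  /-- (6.57) `c₀(0) ≥ -(1+ε₀)^{-n₀/4}`. -/
  c_ge : -(1 + ε₀) ^ (-(n₀ : ℝ) / 4) ≤ Y 2 0 0
  /-- (6.58) `|d₀(0)| ≤ K^{-10}`. -/
  d_abs_le : |Y 3 0 0| ≤ (K ^ 10)⁻¹
  /-- (6.59) `Ẽ_{-1}(0) ≤ K^{-20}`. -/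
  energy_prev_le : F (-1) 0 ≤ (K ^ 20)⁻¹
  /-- (6.60) if `N > n₀`: `b_{-1}(0) ≥ 10⁻⁵ ε`. -/
  b_prev_ge : n₀ < N → 1 / 10 ^ 5 * ε ≤ Y 1 (-1) 0
  /-- (6.61) if `N > n₀`: `b_{-1}(0) ≤ 10⁵ ε`. -/
  b_prev_le : n₀ < N → Y 1 (-1) 0 ≤ 10 ^ 5 * ε
  /-- (6.62) if `N > n₀`: `c_{-1}(0) ≥ exp(K⁹) ε²`. -/
  c_prev_ge : n₀ < N → Real.exp (K ^ 9) * ε ^ 2 ≤ Y 2 (-1) 0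
  /-- (6.63) if `N > n₀`: `c_{-1}(0) ≤ exp(K¹⁰) ε²`. -/
  c_prev_le : n₀ < N → Y 2 (-1) 0 ≤ Real.exp (K ^ 10) * ε ^ 2
  /-- (6.64): for `n₀-N < k ≤ 0`, `m ≥ 2`, `τ_{k-1} ≤ t ≤ τ_k`:
  `Ẽ_{k-m}(t) ≤ K^{-10} (1+ε₀)^{m/10 + |k-1|/50}`. -/
  en_before : ∀ k, n₀ - N < k → k ≤ 0 → ∀ m : ℕ, 2 ≤ m → ∀ t ∈ Icc (τ (k - 1)) (τ k),
    F (k - m) t ≤ (K ^ 10)⁻¹ * (1 + ε₀) ^ ((m : ℝ) / 10 + |(k : ℝ) - 1| / 50)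
  /-- (6.65): for `n₀-N < k ≤ 0`, `τ_{k-1} ≤ t ≤ τ_k`: `Ẽ_{k-1}(t) + Ẽ_k(t) ≤ (1+ε₀)^{|k-1|/50}`. -/
  en_during : ∀ k, n₀ - N < k → k ≤ 0 → ∀ t ∈ Icc (τ (k - 1)) (τ k),
    F (k - 1) t + F k t ≤ (1 + ε₀) ^ (|(k : ℝ) - 1| / 50)
  /-- (6.66): for `n₀-N < k ≤ 0`, `m ≥ 1`, `τ_{k-1} ≤ t ≤ τ_k`:
  `Ẽ_{k+m}(t) ≤ K^{-30} (1+ε₀)^{-10m + |k-1|/50}`. -/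
  en_after : ∀ k, n₀ - N < k → k ≤ 0 → ∀ m : ℕ, 1 ≤ m → ∀ t ∈ Icc (τ (k - 1)) (τ k),
    F (k + m) t ≤ (K ^ 30)⁻¹ * (1 + ε₀) ^ (-(10 : ℝ) * m + |(k : ℝ) - 1| / 50)
  /-- The rescaled asymmetries `Z_{a,k}, Z_{c,k}, Z_{d,k}` are continuously differentiable on `[τ_{n₀-N}, +∞)`. -/
  contDiffOn_W : ∀ i k, ContDiffOn ℝ 1 (W i k) (Ici (τ (n₀ - N)))
  /-- (6.43♯): a priori regularity of the asymmetries. -/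
  apriori_W : ∀ T : ℝ, τ (n₀ - N) < T → ∃ M : ℝ, ∀ t ∈ Icc (τ (n₀ - N)) T, ∀ k : ℤ,
    (1 + (1 + ε₀) ^ ((10 : ℝ) * k)) * (|W 0 k t| + |W 1 k t| + |W 2 k t|) ≤ M
  /-- (6.Z1) rescaled: `∂Z_a = Λ_k(εbZ_a + ε²e^{-K¹⁰}cZ_a - ε⁻²cZ_d + ε⁻²dZ_c) + O(…)`. -/
  eqZ1 : ∀ k t, τ (n₀ - N) ≤ t →
    |derivWithin (W 0 k) (Ici (τ (n₀ - N))) t - (1 + ε₀) ^ ((5 : ℝ) * k / 2) *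
        (ε * Y 1 k t * W 0 k t + ε ^ 2 * Real.exp (-K ^ 10) * Y 2 k t * W 0 k t -
          (ε ^ 2)⁻¹ * Y 2 k t * W 2 k t + (ε ^ 2)⁻¹ * Y 3 k t * W 1 k t)| ≤
      C₁ * (1 + ε₀) ^ ((2 : ℝ) * k - n₀ / 2) * Real.sqrt (F k t)
  /-- (6.Z2) rescaled: `∂Z_c = -Λ_k ε⁻¹K¹⁰ b Z_c + O(…)`. -/
  eqZ2 : ∀ k t, τ (n₀ - N) ≤ t →
    |derivWithin (W 1 k) (Ici (τ (n₀ - N))) t - (1 + ε₀) ^ ((5 : ℝ) * k / 2) *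
        (-(ε⁻¹ * K ^ 10 * Y 1 k t * W 1 k t))| ≤
      C₁ * (1 + ε₀) ^ ((2 : ℝ) * k - n₀ / 2) * Real.sqrt (F k t)
  /-- (6.Z3) rescaled: `∂Z_d = Λ_k(ε⁻²cZ_a - ε⁻²aZ_c + (1+ε₀)^{5/2}K a_{k+1}Z_d) + O(…)`. -/
  eqZ3 : ∀ k t, τ (n₀ - N) ≤ t →
    |derivWithin (W 2 k) (Ici (τ (n₀ - N))) t - (1 + ε₀) ^ ((5 : ℝ) * k / 2) *
        ((ε ^ 2)⁻¹ * Y 2 k t * W 0 k t - (ε ^ 2)⁻¹ * Y 0 k t * W 1 k t +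
          (1 + ε₀) ^ ((5 : ℝ) / 2) * K * Y 0 (k + 1) t * W 2 k t)| ≤
      C₁ * (1 + ε₀) ^ ((2 : ℝ) * k - n₀ / 2) * Real.sqrt (F k t)
  /-- (6.50♯): the asymmetries vanish at the initial time for `k > n₀-N`. -/
  init_W : ∀ i k, n₀ - N < k → W i k (τ (n₀ - N)) = 0
  /-- (6.52♯): no very low frequencies, asymmetries. -/
  noLow_W : ∀ i k t, k < n₀ - N → τ (n₀ - N) ≤ t → W i k t = 0
  /-- (Z-profile) at the checkpoint `k = 0`, `t = 0`: `|Z_{i,m}(0)| ≤ η(m)` for every `m ≥ 0` (fresh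
  and dormant shells). -/
  w_abs_le : ∀ (i : Fin 3) (m : ℕ), |W i m 0| ≤ η m
  /-- (Z-profile) if `N > n₀`: `|Z_{i,-1}(0)| ≤ η(-1)` (previous shell). -/
  w_prev_abs_le : n₀ < N → ∀ i : Fin 3, |W i (-1) 0| ≤ η (-1)
  /-- (clock profile) dormant clocks are not too negative: `b_m(0) ≥ -β(m)` for `m ≥ 1`. -/
  clock_dormant_ge : ∀ m : ℕ, 1 ≤ m → -β m ≤ Y 1 m 0

/-! ## The rescaling of a split solution with checkpoints and profile -/

section Hypotheses

variable {γ ε₀ K ε C₁ C₂ : ℝ} {n₀ N : ℤ} {X : Fin 4 → ℤ → ℝ → ℝ} {Z : Fin 3 → ℤ → ℝ → ℝ}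
  {E : ℤ → ℝ → ℝ} {t e : ℤ → ℝ} {η : ℤ → ℝ} {β : ℕ → ℝ}
set_option maxHeartbeats 400000 in -- buildfix (bf3-g25): 160k/180k FAIL, 200k PASS at accept time; line-neutral budget line
/-- **The hypotheses of the split Prop. 6.5 from a split solution with checkpoints (6.11)–(6.27)_γ
and profile `SplitAsymmetryProfile η β` at level `N`, by the rescaling (6.82)–(6.84)** (port of the
tree's `TaoODESystem.rescaledHypotheses`; `C₃ = tauConst ε₀`). [cite: Tao2016AveragedNS, §6.4 p. 59] -/
theorem SplitODESystem.rescaledSplitHypotheses (hsol : SplitODESystem ε₀ K ε C₁ C₂ n₀ X Z E)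
    (h : BlowupCheckpointsWith γ ε₀ K ε n₀ N X E t e)
    (hP : SplitAsymmetryProfile η β ε₀ K ε n₀ X Z E N t e) (hε₀ : 0 < ε₀) (hN : n₀ ≤ N)
    (hC₁ : 0 ≤ C₁) (hC₂ : 0 ≤ C₂) :
    RescaledSplitHypotheses γ ε₀ K ε C₁ C₂ (tauConst ε₀) n₀ N η β (rescTime ε₀ t e N)
      (rescMode ε₀ t e N X) (rescModeZ ε₀ t e N Z) (rescEnergy ε₀ t e N E) := by
  have h0q : (0 : ℝ) < 1 + ε₀ := by linarith
  have heN : 0 < e N := h.amp_pos hN le_rfl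
  have hc : 0 < (e N)⁻¹ := inv_pos.2 heN
  set lam := rescScale ε₀ e N with hlam_def
  have hlam : 0 < lam := rescScale_pos hε₀ heN
  have hmulQ : lam * (1 + ε₀) ^ ((5 : ℝ) * N / 2) = (e N)⁻¹ := rescScale_mul_rpow hε₀ N e
  set τ₀ := rescTime ε₀ t e N (n₀ - N) with hτ₀_def
  have hτ₀ : t N + lam * τ₀ = 0 := by
    rw [hτ₀_def, hlam_def, time_add_rescScale_mul_rescTime hε₀ heN]
    have : N + (n₀ - N) = n₀ := by ring
    rw [this, h.t_init]
  have hmaps := mapsTo_affine hlam hτ₀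
  have hp : ∀ {s : ℝ}, τ₀ ≤ s → 0 ≤ t N + lam * s := fun hs => hmaps (mem_Ici.2 hs)
  have hw := h.rescScale_mul_rpow_le hε₀ hN
  have hsplit : ∀ k : ℤ, (1 + ε₀) ^ ((5 : ℝ) * ((N + k : ℤ) : ℝ) / 2) =
      (1 + ε₀) ^ ((5 : ℝ) * N / 2) * (1 + ε₀) ^ ((5 : ℝ) * k / 2) := by
    intro k; rw [← Real.rpow_add h0q]; congr 1; push_cast; ring
  -- the common estimate of the error terms
  have herr : ∀ (k : ℤ) (s : ℝ), τ₀ ≤ s →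
      (e N)⁻¹ * lam * (C₁ * (1 + ε₀) ^ ((2 : ℝ) * ((N + k : ℤ) : ℝ)) *
        Real.sqrt (E (N + k) (t N + lam * s))) ≤
      C₁ * (1 + ε₀) ^ ((2 : ℝ) * k - n₀ / 2) * Real.sqrt (rescEnergy ε₀ t e N E k s) := by
    intro k s hs
    have hsq : Real.sqrt (rescEnergy ε₀ t e N E k s) =
        (e N)⁻¹ * Real.sqrt (E (N + k) (t N + lam * s)) := by
      show Real.sqrt ((e N)⁻¹ ^ 2 * E (N + k) (t N + lam * s)) = _
      rw [Real.sqrt_mul (sq_nonneg _), Real.sqrt_sq hc.le]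
    rw [hsq]
    have hE : 0 ≤ Real.sqrt (E (N + k) (t N + lam * s)) := Real.sqrt_nonneg _
    calc (e N)⁻¹ * lam * (C₁ * (1 + ε₀) ^ ((2 : ℝ) * ((N + k : ℤ) : ℝ)) *
          Real.sqrt (E (N + k) (t N + lam * s)))
        = C₁ * (lam * (1 + ε₀) ^ ((2 : ℝ) * ((N + k : ℤ) : ℝ))) *
            ((e N)⁻¹ * Real.sqrt (E (N + k) (t N + lam * s))) := by ring
      _ ≤ C₁ * (1 + ε₀) ^ ((2 : ℝ) * k - n₀ / 2) *
            ((e N)⁻¹ * Real.sqrt (E (N + k) (t N + lam * s))) := by gcongr; exact hw k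
  have hQ : 0 < (1 + ε₀) ^ ((5 : ℝ) * N / 2) * e N := mul_pos (Real.rpow_pos_of_pos h0q _) heN
  have hst := h.state N hN le_rfl
  -- the point `t_N + λ s` lies in `[t_{N+k-1}, t_{N+k}]` when `s ∈ [τ_{k-1}, τ_k]`
  have hseg : ∀ k : ℤ, ∀ s ∈ Icc (rescTime ε₀ t e N (k - 1)) (rescTime ε₀ t e N k),
      t N + lam * s ∈ Icc (t (N + k - 1)) (t (N + k)) := by
    intro k s hs
    constructor
    · calc t (N + k - 1) = t (N + (k - 1)) := by ring_nf
        _ = t N + lam * rescTime ε₀ t e N (k - 1) :=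
            (time_add_rescScale_mul_rescTime hε₀ heN (k - 1)).symm
        _ ≤ t N + lam * s := by have := hs.1; nlinarith
    · calc t N + lam * s ≤ t N + lam * rescTime ε₀ t e N k := by have := hs.2; nlinarith
        _ = t (N + k) := time_add_rescScale_mul_rescTime hε₀ heN k
  -- `(e_{N+k-1}/e_N)² ≤ (1+ε₀)^{|k-1|/50}` for `n₀ < N + k ≤ N`
  have hsq : ∀ k : ℤ, n₀ - N < k → k ≤ 0 →
      (e N)⁻¹ ^ 2 * e (N + k - 1) ^ 2 ≤ (1 + ε₀) ^ (|(k : ℝ) - 1| / 50) := by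
    intro k hk hk0
    have hrat := (h.amp_ratio hε₀ (m := N + k - 1) (n := N) (by omega) (by omega) le_rfl).2
    have hek : 0 < e (N + k - 1) := h.amp_pos (by omega) (by omega)
    have hkr : (k : ℝ) ≤ 0 := by exact_mod_cast hk0
    have habs : |(k : ℝ) - 1| = 1 - k := by
      rw [abs_of_nonpos (by linarith)]; ring
    have hexp : ((N : ℝ) - ((N + k - 1 : ℤ) : ℝ)) / 100 = (1 - (k : ℝ)) / 100 := by
      push_cast; ring
    rw [hexp] at hrat
    have hle : (e N)⁻¹ * e (N + k - 1) ≤ (1 + ε₀) ^ ((1 - (k : ℝ)) / 100) := by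
      rw [inv_mul_le_iff₀ heN]; linarith [hrat]
    have hnn : 0 ≤ (e N)⁻¹ * e (N + k - 1) := by positivity
    calc (e N)⁻¹ ^ 2 * e (N + k - 1) ^ 2 = ((e N)⁻¹ * e (N + k - 1)) ^ 2 := by ring
      _ ≤ ((1 + ε₀) ^ ((1 - (k : ℝ)) / 100)) ^ 2 := pow_le_pow_left₀ hnn hle 2
      _ = (1 + ε₀) ^ (|(k : ℝ) - 1| / 50) := by
          rw [← Real.rpow_natCast, ← Real.rpow_mul h0q.le, habs]; congr 1; push_cast; ring
  refine
    { tau_zero := rescTime_zero ε₀ t e N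
      tau_lt := ?_
      contDiffOn_Y := fun i k => contDiffOn_rescale _ hlam hτ₀ (hsol.contDiffOn_S i (N + k))
      contDiffOn_F := fun k => contDiffOn_rescale _ hlam hτ₀ (hsol.contDiffOn_E (N + k))
      nonneg_F := fun k s hs => mul_nonneg (sq_nonneg _) (hsol.nonneg_E _ _ (hp hs))
      apriori_Y := ?_
      apriori_F := ?_
      eq1 := ?_
      eq2 := ?_
      eq3 := ?_
      eq4 := ?_
      energy := ?_
      init_Y := ?_
      init_F := ?_
      defect_lower := ?_
      defect_upper := ?_
      noLow_Y := fun i k s hk hs => by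
        show (e N)⁻¹ * X i (N + k) (t N + lam * s) = 0
        rw [hsol.noLow_S i (N + k) _ (by omega) (hp hs), mul_zero]
      noLow_F := fun k s hk hs => by
        show (e N)⁻¹ ^ 2 * E (N + k) (t N + lam * s) = 0
        rw [hsol.noLow_E (N + k) _ (by omega) (hp hs), mul_zero]
      contDiffOn_W := fun i k => contDiffOn_rescale _ hlam hτ₀ (hsol.contDiffOn_Z i (N + k))
      apriori_W := by
        intro T _hT
        obtain ⟨M, hM⟩ := hsol.apriori_Z (|t N + lam * T| + 1) (by positivity)
        refine ⟨(e N)⁻¹ * (1 + (1 + ε₀) ^ (-(10 : ℝ) * N)) * (3 * M), fun s hs k => ?_⟩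
        have hps : 0 ≤ t N + lam * s := hp hs.1
        have hpT : t N + lam * s ≤ |t N + lam * T| + 1 := by
          have h1 : t N + lam * s ≤ t N + lam * T := by have := hs.2; nlinarith
          exact h1.trans ((le_abs_self _).trans (by linarith))
        have hMi := fun i => hM _ ⟨hps, hpT⟩ i (N + k)
        have hprod : (1 + ε₀) ^ (-(10 : ℝ) * N) * (1 + ε₀) ^ ((10 : ℝ) * ((N + k : ℤ) : ℝ)) =
            (1 + ε₀) ^ ((10 : ℝ) * k) := by
          rw [← Real.rpow_add h0q]; congr 1; push_cast; ring
        have hA : 1 + (1 + ε₀) ^ ((10 : ℝ) * k) ≤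
            (1 + (1 + ε₀) ^ (-(10 : ℝ) * N)) * (1 + (1 + ε₀) ^ ((10 : ℝ) * ((N + k : ℤ) : ℝ))) := by
          rw [← hprod]
          nlinarith [Real.rpow_pos_of_pos h0q (-(10 : ℝ) * N),
            Real.rpow_pos_of_pos h0q ((10 : ℝ) * ((N + k : ℤ) : ℝ))]
        show (1 + (1 + ε₀) ^ ((10 : ℝ) * k)) * (|(e N)⁻¹ * Z 0 (N + k) (t N + lam * s)| +
          |(e N)⁻¹ * Z 1 (N + k) (t N + lam * s)| + |(e N)⁻¹ * Z 2 (N + k) (t N + lam * s)|) ≤ _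
        simp only [abs_mul, abs_of_pos hc]
        have ha0 := abs_nonneg (Z 0 (N + k) (t N + lam * s))
        have ha1 := abs_nonneg (Z 1 (N + k) (t N + lam * s))
        have ha2 := abs_nonneg (Z 2 (N + k) (t N + lam * s))
        calc (1 + (1 + ε₀) ^ ((10 : ℝ) * k)) *
              ((e N)⁻¹ * |Z 0 (N + k) (t N + lam * s)| + (e N)⁻¹ * |Z 1 (N + k) (t N + lam * s)| +
                (e N)⁻¹ * |Z 2 (N + k) (t N + lam * s)|)
            = (1 + (1 + ε₀) ^ ((10 : ℝ) * k)) * ((e N)⁻¹ * (|Z 0 (N + k) (t N + lam * s)| +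
                |Z 1 (N + k) (t N + lam * s)| + |Z 2 (N + k) (t N + lam * s)|)) := by ring
          _ ≤ (1 + (1 + ε₀) ^ (-(10 : ℝ) * N)) * (1 + (1 + ε₀) ^ ((10 : ℝ) * ((N + k : ℤ) : ℝ))) *
                ((e N)⁻¹ * (|Z 0 (N + k) (t N + lam * s)| + |Z 1 (N + k) (t N + lam * s)| +
                  |Z 2 (N + k) (t N + lam * s)|)) := by gcongr
          _ = (e N)⁻¹ * (1 + (1 + ε₀) ^ (-(10 : ℝ) * N)) *
                ((1 + (1 + ε₀) ^ ((10 : ℝ) * ((N + k : ℤ) : ℝ))) * |Z 0 (N + k) (t N + lam * s)| +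
                  (1 + (1 + ε₀) ^ ((10 : ℝ) * ((N + k : ℤ) : ℝ))) * |Z 1 (N + k) (t N + lam * s)| +
                  (1 + (1 + ε₀) ^ ((10 : ℝ) * ((N + k : ℤ) : ℝ))) * |Z 2 (N + k) (t N + lam * s)|) := by
              ring
          _ ≤ (e N)⁻¹ * (1 + (1 + ε₀) ^ (-(10 : ℝ) * N)) * (3 * M) := by
              gcongr; linarith [hMi 0, hMi 1, hMi 2]
      eqZ1 := by
        intro k s hs
        have hd := derivWithin_rescale (e N)⁻¹ hlam hτ₀ (hsol.contDiffOn_Z 0 (N + k)) hs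
        have hX := hsol.eqZ1 (N + k) (t N + lam * s) (hp hs)
        rw [hsplit k] at hX
        refine (abs_rescale_le hc hlam hd hmulQ ?_ hX).trans (herr k s hs)
        simp only [rescMode, rescModeZ]; ring
      eqZ2 := by
        intro k s hs
        have hd := derivWithin_rescale (e N)⁻¹ hlam hτ₀ (hsol.contDiffOn_Z 1 (N + k)) hs
        have hX := hsol.eqZ2 (N + k) (t N + lam * s) (hp hs)
        rw [hsplit k] at hX
        refine (abs_rescale_le hc hlam hd hmulQ ?_ hX).trans (herr k s hs)
        simp only [rescMode, rescModeZ]; ring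
      eqZ3 := by
        intro k s hs
        have hd := derivWithin_rescale (e N)⁻¹ hlam hτ₀ (hsol.contDiffOn_Z 2 (N + k)) hs
        have hX := hsol.eqZ3 (N + k) (t N + lam * s) (hp hs)
        rw [hsplit k] at hX
        have e1 : N + k + 1 = N + (k + 1) := by ring
        rw [e1] at hX
        refine (abs_rescale_le hc hlam hd hmulQ ?_ hX).trans (herr k s hs)
        simp only [rescMode, rescModeZ]; ring
      init_W := fun i k hk => by
        show (e N)⁻¹ * Z i (N + k) (t N + lam * τ₀) = 0
        rw [hτ₀, hsol.init_Z, mul_zero]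
      noLow_W := fun i k s hk hs => by
        show (e N)⁻¹ * Z i (N + k) (t N + lam * s) = 0
        rw [hsol.noLow_Z i (N + k) _ (by omega) (hp hs), mul_zero]
      w_abs_le := fun i m => by
        show |(e N)⁻¹ * Z i (N + m) (t N + lam * 0)| ≤ η m
        rw [mul_zero, add_zero, abs_mul, abs_of_pos hc, inv_mul_le_iff₀ heN]
        have := hP.1 i m
        linarith
      w_prev_abs_le := fun hn i => by
        show |(e N)⁻¹ * Z i (N + -1) (t N + lam * 0)| ≤ η (-1)
        have e1 : N + -1 = N - 1 := by ring
        rw [mul_zero, add_zero, e1, abs_mul, abs_of_pos hc, inv_mul_le_iff₀ heN]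
        have := hP.2.1 hn i
        linarith
      clock_dormant_ge := fun m hm => by
        show -β m ≤ (e N)⁻¹ * X 1 (N + m) (t N + lam * 0)
        rw [mul_zero, add_zero, le_inv_mul_iff₀ heN]
        have := hP.2.2 m hm
        linarith
      tau_ge := ?_
      tau_le := ?_
      a_eq := ?_
      b_abs_le := ?_
      c_abs_le := ?_
      c_ge := ?_
      d_abs_le := ?_
      energy_prev_le := ?_
      b_prev_ge := ?_
      b_prev_le := ?_
      c_prev_ge := ?_
      c_prev_le := ?_
      en_before := ?_
      en_during := ?_
      en_after := ?_ }
  · intro k hk hk0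
    have hlt := (h.step (N + k) (by omega) (by omega)).lt
    unfold rescTime
    have e1 : N + (k - 1) = N + k - 1 := by ring
    rw [e1]
    have : t (N + k - 1) - t N < t (N + k) - t N := by linarith
    exact mul_lt_mul_of_pos_left this hQ
  · -- (6.43)
    intro T _hT
    obtain ⟨M, hM⟩ := hsol.apriori_S (|t N + lam * T| + 1) (by positivity)
    refine ⟨(e N)⁻¹ * (1 + (1 + ε₀) ^ (-(10 : ℝ) * N)) * (4 * M), fun s hs k => ?_⟩
    have hps : 0 ≤ t N + lam * s := hp hs.1
    have hpT : t N + lam * s ≤ |t N + lam * T| + 1 := by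
      have h1 : t N + lam * s ≤ t N + lam * T := by have := hs.2; nlinarith
      exact h1.trans ((le_abs_self _).trans (by linarith))
    have hMi := fun i => hM _ ⟨hps, hpT⟩ i (N + k)
    have hprod : (1 + ε₀) ^ (-(10 : ℝ) * N) * (1 + ε₀) ^ ((10 : ℝ) * ((N + k : ℤ) : ℝ)) =
        (1 + ε₀) ^ ((10 : ℝ) * k) := by
      rw [← Real.rpow_add h0q]; congr 1; push_cast; ring
    have hA : 1 + (1 + ε₀) ^ ((10 : ℝ) * k) ≤
        (1 + (1 + ε₀) ^ (-(10 : ℝ) * N)) * (1 + (1 + ε₀) ^ ((10 : ℝ) * ((N + k : ℤ) : ℝ))) := by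
      rw [← hprod]
      nlinarith [Real.rpow_pos_of_pos h0q (-(10 : ℝ) * N),
        Real.rpow_pos_of_pos h0q ((10 : ℝ) * ((N + k : ℤ) : ℝ))]
    show (1 + (1 + ε₀) ^ ((10 : ℝ) * k)) * (|(e N)⁻¹ * X 0 (N + k) (t N + lam * s)| +
      |(e N)⁻¹ * X 1 (N + k) (t N + lam * s)| + |(e N)⁻¹ * X 2 (N + k) (t N + lam * s)| +
        |(e N)⁻¹ * X 3 (N + k) (t N + lam * s)|) ≤ _
    simp only [abs_mul, abs_of_pos hc]
    have ha0 := abs_nonneg (X 0 (N + k) (t N + lam * s))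
    have ha1 := abs_nonneg (X 1 (N + k) (t N + lam * s))
    have ha2 := abs_nonneg (X 2 (N + k) (t N + lam * s))
    have ha3 := abs_nonneg (X 3 (N + k) (t N + lam * s))
    calc (1 + (1 + ε₀) ^ ((10 : ℝ) * k)) *
          ((e N)⁻¹ * |X 0 (N + k) (t N + lam * s)| + (e N)⁻¹ * |X 1 (N + k) (t N + lam * s)| +
            (e N)⁻¹ * |X 2 (N + k) (t N + lam * s)| + (e N)⁻¹ * |X 3 (N + k) (t N + lam * s)|)
        = (1 + (1 + ε₀) ^ ((10 : ℝ) * k)) * ((e N)⁻¹ * (|X 0 (N + k) (t N + lam * s)| +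
            |X 1 (N + k) (t N + lam * s)| + |X 2 (N + k) (t N + lam * s)| +
              |X 3 (N + k) (t N + lam * s)|)) := by ring
      _ ≤ (1 + (1 + ε₀) ^ (-(10 : ℝ) * N)) * (1 + (1 + ε₀) ^ ((10 : ℝ) * ((N + k : ℤ) : ℝ))) *
            ((e N)⁻¹ * (|X 0 (N + k) (t N + lam * s)| + |X 1 (N + k) (t N + lam * s)| +
              |X 2 (N + k) (t N + lam * s)| + |X 3 (N + k) (t N + lam * s)|)) := by gcongr
      _ = (e N)⁻¹ * (1 + (1 + ε₀) ^ (-(10 : ℝ) * N)) *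
            ((1 + (1 + ε₀) ^ ((10 : ℝ) * ((N + k : ℤ) : ℝ))) * |X 0 (N + k) (t N + lam * s)| +
              (1 + (1 + ε₀) ^ ((10 : ℝ) * ((N + k : ℤ) : ℝ))) * |X 1 (N + k) (t N + lam * s)| +
              (1 + (1 + ε₀) ^ ((10 : ℝ) * ((N + k : ℤ) : ℝ))) * |X 2 (N + k) (t N + lam * s)| +
              (1 + (1 + ε₀) ^ ((10 : ℝ) * ((N + k : ℤ) : ℝ))) * |X 3 (N + k) (t N + lam * s)|) := by
          ring
      _ ≤ (e N)⁻¹ * (1 + (1 + ε₀) ^ (-(10 : ℝ) * N)) * (4 * M) := by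
          gcongr; linarith [hMi 0, hMi 1, hMi 2, hMi 3]
  · -- (6.44)
    intro T _hT
    obtain ⟨M, hM⟩ := hsol.apriori_E (|t N + lam * T| + 1) (by positivity)
    refine ⟨(e N)⁻¹ * (1 + (1 + ε₀) ^ (-(10 : ℝ) * N)) * M, fun s hs k => ?_⟩
    have hps : 0 ≤ t N + lam * s := hp hs.1
    have hpT : t N + lam * s ≤ |t N + lam * T| + 1 := by
      have h1 : t N + lam * s ≤ t N + lam * T := by have := hs.2; nlinarith
      exact h1.trans ((le_abs_self _).trans (by linarith))
    have hMk := hM _ ⟨hps, hpT⟩ (N + k)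
    have hprod : (1 + ε₀) ^ (-(10 : ℝ) * N) * (1 + ε₀) ^ ((10 : ℝ) * ((N + k : ℤ) : ℝ)) =
        (1 + ε₀) ^ ((10 : ℝ) * k) := by
      rw [← Real.rpow_add h0q]; congr 1; push_cast; ring
    have hA : 1 + (1 + ε₀) ^ ((10 : ℝ) * k) ≤
        (1 + (1 + ε₀) ^ (-(10 : ℝ) * N)) * (1 + (1 + ε₀) ^ ((10 : ℝ) * ((N + k : ℤ) : ℝ))) := by
      rw [← hprod]
      nlinarith [Real.rpow_pos_of_pos h0q (-(10 : ℝ) * N),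
        Real.rpow_pos_of_pos h0q ((10 : ℝ) * ((N + k : ℤ) : ℝ))]
    have hsq : Real.sqrt (rescEnergy ε₀ t e N E k s) =
        (e N)⁻¹ * Real.sqrt (E (N + k) (t N + lam * s)) := by
      show Real.sqrt ((e N)⁻¹ ^ 2 * E (N + k) (t N + lam * s)) = _
      rw [Real.sqrt_mul (sq_nonneg _), Real.sqrt_sq hc.le]
    have hS : 0 ≤ Real.sqrt (E (N + k) (t N + lam * s)) := Real.sqrt_nonneg _
    calc (1 + (1 + ε₀) ^ ((10 : ℝ) * k)) * Real.sqrt (rescEnergy ε₀ t e N E k s)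
        = (1 + (1 + ε₀) ^ ((10 : ℝ) * k)) * ((e N)⁻¹ * Real.sqrt (E (N + k) (t N + lam * s))) := by
          rw [hsq]
      _ ≤ (1 + (1 + ε₀) ^ (-(10 : ℝ) * N)) * (1 + (1 + ε₀) ^ ((10 : ℝ) * ((N + k : ℤ) : ℝ))) *
            ((e N)⁻¹ * Real.sqrt (E (N + k) (t N + lam * s))) := by gcongr
      _ = (e N)⁻¹ * (1 + (1 + ε₀) ^ (-(10 : ℝ) * N)) *
            ((1 + (1 + ε₀) ^ ((10 : ℝ) * ((N + k : ℤ) : ℝ))) *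
              Real.sqrt (E (N + k) (t N + lam * s))) := by ring
      _ ≤ (e N)⁻¹ * (1 + (1 + ε₀) ^ (-(10 : ℝ) * N)) * M := by gcongr
  · -- (6.45)
    intro k s hs
    have hd := derivWithin_rescale (e N)⁻¹ hlam hτ₀ (hsol.contDiffOn_S 0 (N + k)) hs
    have hX := hsol.eq1 (N + k) (t N + lam * s) (hp hs)
    rw [hsplit k] at hX
    have e1 : N + k - 1 = N + (k - 1) := by ring
    rw [e1] at hX
    refine (abs_rescale_le hc hlam hd hmulQ ?_ hX).trans (herr k s hs)
    simp only [rescMode, rescModeZ]; ring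
  · -- (6.46)
    intro k s hs
    have hd := derivWithin_rescale (e N)⁻¹ hlam hτ₀ (hsol.contDiffOn_S 1 (N + k)) hs
    have hX := hsol.eq2 (N + k) (t N + lam * s) (hp hs)
    rw [hsplit k] at hX
    refine (abs_rescale_le hc hlam hd hmulQ ?_ hX).trans (herr k s hs)
    simp only [rescMode, rescModeZ]; ring
  · -- (6.47)
    intro k s hs
    have hd := derivWithin_rescale (e N)⁻¹ hlam hτ₀ (hsol.contDiffOn_S 2 (N + k)) hs
    have hX := hsol.eq3 (N + k) (t N + lam * s) (hp hs)
    rw [hsplit k] at hX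
    refine (abs_rescale_le hc hlam hd hmulQ ?_ hX).trans (herr k s hs)
    simp only [rescMode, rescModeZ]; ring
  · -- (6.48)
    intro k s hs
    have hd := derivWithin_rescale (e N)⁻¹ hlam hτ₀ (hsol.contDiffOn_S 3 (N + k)) hs
    have hX := hsol.eq4 (N + k) (t N + lam * s) (hp hs)
    rw [hsplit k] at hX
    have e1 : N + k + 1 = N + (k + 1) := by ring
    rw [e1] at hX
    refine (abs_rescale_le hc hlam hd hmulQ ?_ hX).trans (herr k s hs)
    simp only [rescMode, rescModeZ]; ring
  · -- (6.49)
    intro k s hs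
    have hd := derivWithin_rescale ((e N)⁻¹ ^ 2) hlam hτ₀ (hsol.contDiffOn_E (N + k)) hs
    have hX := hsol.energy (N + k) (t N + lam * s) (hp hs)
    have hsplit' : (1 + ε₀) ^ ((5 : ℝ) * (((N + k : ℤ) : ℝ) + 1) / 2) =
        (1 + ε₀) ^ ((5 : ℝ) * N / 2) * (1 + ε₀) ^ ((5 : ℝ) * k / 2) *
          (1 + ε₀) ^ ((5 : ℝ) / 2) := by
      rw [← Real.rpow_add h0q, ← Real.rpow_add h0q]; congr 1; push_cast; ring
    rw [hsplit k, hsplit'] at hX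
    have e1 : N + k - 1 = N + (k - 1) := by ring
    have e2 : N + k + 1 = N + (k + 1) := by ring
    rw [e1, e2] at hX
    change derivWithin (fun u => (e N)⁻¹ ^ 2 * E (N + k) (t N + lam * u)) (Ici τ₀) s ≤ _
    rw [hd]
    simp only [rescMode, rescModeZ]
    have hcl : 0 ≤ (e N)⁻¹ ^ 2 * lam := by positivity
    refine (mul_le_mul_of_nonneg_left hX hcl).trans_eq ?_
    linear_combination (K * (1 + ε₀) ^ ((5 : ℝ) * k / 2) *
      ((X 3 (N + (k - 1)) (t N + lam * s) ^ 2 - Z 2 (N + (k - 1)) (t N + lam * s) ^ 2) *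
          X 0 (N + k) (t N + lam * s) -
        (1 + ε₀) ^ ((5 : ℝ) / 2) * (X 3 (N + k) (t N + lam * s) ^ 2 -
          Z 2 (N + k) (t N + lam * s) ^ 2) * X 0 (N + (k + 1)) (t N + lam * s)) *
        (e N)⁻¹ ^ 2) * hmulQ
  · -- (6.50), modes
    intro i k hk
    show (e N)⁻¹ * X i (N + k) (t N + lam * τ₀) = 0
    rw [hτ₀, hsol.init_S, if_neg, mul_zero]
    rintro ⟨-, h2⟩
    omega
  · -- (6.50), energies
    intro k hk
    show (e N)⁻¹ ^ 2 * E (N + k) (t N + lam * τ₀) = 0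
    rw [hτ₀, hsol.init_E, if_neg, mul_zero]
    omega
  · -- (6.51), lower
    intro k s hs
    have hX := hsol.defect_lower (N + k) (t N + lam * s) (hp hs)
    show (1 / 2) * (∑ i, ((e N)⁻¹ * X i (N + k) (t N + lam * s)) ^ 2 +
        ∑ i, ((e N)⁻¹ * Z i (N + k) (t N + lam * s)) ^ 2) ≤
      (e N)⁻¹ ^ 2 * E (N + k) (t N + lam * s)
    simp only [Fin.sum_univ_four, Fin.sum_univ_three] at hX ⊢
    have h2 := mul_le_mul_of_nonneg_left hX (sq_nonneg (e N)⁻¹)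
    nlinarith [h2, sq_nonneg (e N)⁻¹]
  · -- (6.51), upper
    intro k s hs
    have hX := hsol.defect_upper (N + k) (t N + lam * s) (hp hs)
    have hI : ∫ u in τ₀..s, rescEnergy ε₀ t e N E k u =
        (e N)⁻¹ ^ 2 * lam⁻¹ * ∫ x in (0 : ℝ)..(t N + lam * s), E (N + k) x := by
      show (∫ u in τ₀..s, (e N)⁻¹ ^ 2 * E (N + k) (t N + lam * u)) = _
      exact integral_rescale _ hlam hτ₀ s
    have hInn : 0 ≤ ∫ u in τ₀..s, rescEnergy ε₀ t e N E k u :=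
      intervalIntegral.integral_nonneg hs fun u hu =>
        mul_nonneg (sq_nonneg _) (hsol.nonneg_E _ _ (hp hu.1))
    have hI' : ∫ x in (0 : ℝ)..(t N + lam * s), E (N + k) x =
        (e N) ^ 2 * lam * ∫ u in τ₀..s, rescEnergy ε₀ t e N E k u := by
      rw [hI]; field_simp
    rw [hI'] at hX
    show (e N)⁻¹ ^ 2 * E (N + k) (t N + lam * s) ≤
      (1 / 2) * (∑ i, ((e N)⁻¹ * X i (N + k) (t N + lam * s)) ^ 2 +
          ∑ i, ((e N)⁻¹ * Z i (N + k) (t N + lam * s)) ^ 2) +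
        C₂ * (1 + ε₀) ^ ((2 : ℝ) * k - n₀ / 2) * ∫ u in τ₀..s, rescEnergy ε₀ t e N E k u
    simp only [Fin.sum_univ_four, Fin.sum_univ_three] at hX ⊢
    have hwk := hw k
    calc (e N)⁻¹ ^ 2 * E (N + k) (t N + lam * s)
        ≤ (e N)⁻¹ ^ 2 * ((1 / 2) * (X 0 (N + k) (t N + lam * s) ^ 2 +
            X 1 (N + k) (t N + lam * s) ^ 2 + X 2 (N + k) (t N + lam * s) ^ 2 +
              X 3 (N + k) (t N + lam * s) ^ 2 + (Z 0 (N + k) (t N + lam * s) ^ 2 +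
              Z 1 (N + k) (t N + lam * s) ^ 2 + Z 2 (N + k) (t N + lam * s) ^ 2)) +
            C₂ * (1 + ε₀) ^ ((2 : ℝ) * ((N + k : ℤ) : ℝ)) *
              ((e N) ^ 2 * lam * ∫ u in τ₀..s, rescEnergy ε₀ t e N E k u)) :=
          mul_le_mul_of_nonneg_left hX (sq_nonneg _)
      _ = (1 / 2) * (((e N)⁻¹ * X 0 (N + k) (t N + lam * s)) ^ 2 +
            ((e N)⁻¹ * X 1 (N + k) (t N + lam * s)) ^ 2 +
              ((e N)⁻¹ * X 2 (N + k) (t N + lam * s)) ^ 2 +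
                ((e N)⁻¹ * X 3 (N + k) (t N + lam * s)) ^ 2 +
              (((e N)⁻¹ * Z 0 (N + k) (t N + lam * s)) ^ 2 +
                ((e N)⁻¹ * Z 1 (N + k) (t N + lam * s)) ^ 2 +
                ((e N)⁻¹ * Z 2 (N + k) (t N + lam * s)) ^ 2)) +
            C₂ * (lam * (1 + ε₀) ^ ((2 : ℝ) * ((N + k : ℤ) : ℝ))) *
              ∫ u in τ₀..s, rescEnergy ε₀ t e N E k u := by
          field_simp
      _ ≤ _ := by gcongr
  
  · intro k hk hk0
    obtain ⟨d, rfl⟩ : ∃ d : ℕ, k = -(d : ℤ) := ⟨(-k).toNat, by omega⟩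
    have hb := h.time_gap_le hε₀ d (by omega)
    have habs : |((-(d : ℤ) : ℤ) : ℝ)| = d := by
      push_cast; rw [abs_neg, Nat.abs_cast]
    rw [habs]
    have hρd : (1 + ε₀) ^ (((5 : ℝ) / 2 + 1 / 100) * (d : ℝ)) =
        ((1 + ε₀) ^ ((5 : ℝ) / 2 + 1 / 100)) ^ d := by
      rw [Real.rpow_mul h0q.le, Real.rpow_natCast]
    rw [hρd]
    unfold rescTime
    have e1 : N + -(d : ℤ) = N - d := by ring
    rw [e1]
    nlinarith [hb, tauConst_nonneg hε₀]
  · intro k hk hk0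
    have hmono := h.time_mono (m := N + k) (n := N) (by omega) (by omega) le_rfl
    unfold rescTime
    exact mul_nonpos_of_nonneg_of_nonpos hQ.le (by linarith)
  · show (e N)⁻¹ * X 0 (N + 0) (t N + lam * 0) = 1
    rw [add_zero, mul_zero, add_zero, hst.x1_eq, inv_mul_cancel₀ heN.ne']
  · show |(e N)⁻¹ * X 1 (N + 0) (t N + lam * 0)| ≤ _
    rw [add_zero, mul_zero, add_zero, abs_mul, abs_of_pos hc]
    calc (e N)⁻¹ * |X 1 N (t N)| ≤ (e N)⁻¹ * (1 / 10 ^ 5 * ε * e N) := by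
          gcongr; exact hst.x2_abs_le
      _ = 1 / 10 ^ 5 * ε := by field_simp
  · show |(e N)⁻¹ * X 2 (N + 0) (t N + lam * 0)| ≤ _
    rw [add_zero, mul_zero, add_zero, abs_mul, abs_of_pos hc]
    calc (e N)⁻¹ * |X 2 N (t N)| ≤ (e N)⁻¹ * (γ * ε ^ 2 * e N) := by
          gcongr; exact hst.x3_abs_le
      _ = γ * ε ^ 2 := by field_simp
  · show -(1 + ε₀) ^ (-(n₀ : ℝ) / 4) ≤ (e N)⁻¹ * X 2 (N + 0) (t N + lam * 0)
    rw [add_zero, mul_zero, add_zero, le_inv_mul_iff₀ heN]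
    linarith [hst.x3_ge]
  · show |(e N)⁻¹ * X 3 (N + 0) (t N + lam * 0)| ≤ _
    rw [add_zero, mul_zero, add_zero, abs_mul, abs_of_pos hc]
    calc (e N)⁻¹ * |X 3 N (t N)| ≤ (e N)⁻¹ * ((K ^ 10)⁻¹ * e N) := by
          gcongr; exact hst.x4_abs_le
      _ = (K ^ 10)⁻¹ := by field_simp
  · show (e N)⁻¹ ^ 2 * E (N + -1) (t N + lam * 0) ≤ _
    have e1 : N + -1 = N - 1 := by ring
    rw [mul_zero, add_zero, e1]
    calc (e N)⁻¹ ^ 2 * E (N - 1) (t N) ≤ (e N)⁻¹ ^ 2 * ((K ^ 20)⁻¹ * e N ^ 2) := by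
          gcongr; exact hst.energy_prev_le
      _ = (K ^ 20)⁻¹ := by field_simp
  · intro hn
    have hsp := h.step N hn le_rfl
    show 1 / 10 ^ 5 * ε ≤ (e N)⁻¹ * X 1 (N + -1) (t N + lam * 0)
    have e1 : N + -1 = N - 1 := by ring
    rw [mul_zero, add_zero, e1, le_inv_mul_iff₀ heN]
    linarith [hsp.x2_prev_ge]
  · intro hn
    have hsp := h.step N hn le_rfl
    show (e N)⁻¹ * X 1 (N + -1) (t N + lam * 0) ≤ 10 ^ 5 * ε
    have e1 : N + -1 = N - 1 := by ring
    rw [mul_zero, add_zero, e1, inv_mul_le_iff₀ heN]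
    linarith [hsp.x2_prev_le]
  · intro hn
    have hsp := h.step N hn le_rfl
    show Real.exp (K ^ 9) * ε ^ 2 ≤ (e N)⁻¹ * X 2 (N + -1) (t N + lam * 0)
    have e1 : N + -1 = N - 1 := by ring
    rw [mul_zero, add_zero, e1, le_inv_mul_iff₀ heN]
    linarith [hsp.x3_prev_ge]
  · intro hn
    have hsp := h.step N hn le_rfl
    show (e N)⁻¹ * X 2 (N + -1) (t N + lam * 0) ≤ Real.exp (K ^ 10) * ε ^ 2
    have e1 : N + -1 = N - 1 := by ring
    rw [mul_zero, add_zero, e1, inv_mul_le_iff₀ heN]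
    linarith [hsp.x3_prev_le]
  · intro k hk hk0 m hm s hs
    have hp := hseg k s hs
    have hb := (h.step (N + k) (by omega) (by omega)).en_before m hm _ hp
    show (e N)⁻¹ ^ 2 * E (N + (k - m)) (t N + lam * s) ≤ _
    have e1 : N + (k - (m : ℤ)) = N + k - m := by ring
    rw [e1, Real.rpow_add h0q]
    have hK : 0 ≤ (K ^ 10)⁻¹ * (1 + ε₀) ^ ((m : ℝ) / 10) := by positivity
    calc (e N)⁻¹ ^ 2 * E (N + k - m) (t N + lam * s)
        ≤ (e N)⁻¹ ^ 2 * ((K ^ 10)⁻¹ * (1 + ε₀) ^ ((m : ℝ) / 10) * e (N + k - 1) ^ 2) := by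
          gcongr
      _ = (K ^ 10)⁻¹ * (1 + ε₀) ^ ((m : ℝ) / 10) * ((e N)⁻¹ ^ 2 * e (N + k - 1) ^ 2) := by ring
      _ ≤ (K ^ 10)⁻¹ * (1 + ε₀) ^ ((m : ℝ) / 10) * (1 + ε₀) ^ (|(k : ℝ) - 1| / 50) :=
          mul_le_mul_of_nonneg_left (hsq k hk hk0) hK
      _ = _ := by ring
  · intro k hk hk0 s hs
    have hp := hseg k s hs
    have hb := (h.step (N + k) (by omega) (by omega)).en_during _ hp
    show (e N)⁻¹ ^ 2 * E (N + (k - 1)) (t N + lam * s) + (e N)⁻¹ ^ 2 * E (N + k) (t N + lam * s) ≤ _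
    have e1 : N + (k - 1) = N + k - 1 := by ring
    rw [e1]
    calc (e N)⁻¹ ^ 2 * E (N + k - 1) (t N + lam * s) + (e N)⁻¹ ^ 2 * E (N + k) (t N + lam * s)
        = (e N)⁻¹ ^ 2 * (E (N + k - 1) (t N + lam * s) + E (N + k) (t N + lam * s)) := by ring
      _ ≤ (e N)⁻¹ ^ 2 * e (N + k - 1) ^ 2 := by gcongr
      _ ≤ _ := hsq k hk hk0
  · intro k hk hk0 m hm s hs
    have hp := hseg k s hs
    have hb := (h.step (N + k) (by omega) (by omega)).en_after m hm _ hp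
    show (e N)⁻¹ ^ 2 * E (N + (k + m)) (t N + lam * s) ≤ _
    have e1 : N + (k + (m : ℤ)) = N + k + m := by ring
    rw [e1, Real.rpow_add h0q]
    have hK : 0 ≤ (K ^ 30)⁻¹ * (1 + ε₀) ^ (-(10 : ℝ) * m) := by positivity
    calc (e N)⁻¹ ^ 2 * E (N + k + m) (t N + lam * s)
        ≤ (e N)⁻¹ ^ 2 * ((K ^ 30)⁻¹ * (1 + ε₀) ^ (-(10 : ℝ) * m) * e (N + k - 1) ^ 2) := by
          gcongr
      _ = (K ^ 30)⁻¹ * (1 + ε₀) ^ (-(10 : ℝ) * m) * ((e N)⁻¹ ^ 2 * e (N + k - 1) ^ 2) := by ring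
      _ ≤ (K ^ 30)⁻¹ * (1 + ε₀) ^ (-(10 : ℝ) * m) * (1 + ε₀) ^ (|(k : ℝ) - 1| / 50) :=
          mul_le_mul_of_nonneg_left (hsq k hk hk0) hK
      _ = _ := by ring

end Hypotheses

/-! ## The conclusion of the split Proposition 6.5, the step, and its un-rescaling -/

/-- **The conclusion of the split Prop. 6.5**: Tao's (6.67)–(6.81) for `(Y, F)` (`base`) together
with the profile at the new checkpoint `(τ₁, μ₁)`: `|W_{i,1+m}(τ₁)| ≤ η(m)μ₁` (`m ≥ 0`),
`|W_{i,0}(τ₁)| ≤ η(-1)μ₁`, `b̃_{1+m}(τ₁) ≥ -β(m)μ₁` (`m ≥ 1`).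
[cite: Tao2016AveragedNS, §6.4 Prop. 6.5 (6.67)–(6.81)] -/
structure RescaledSplitConclusion (γ ε₀ K ε : ℝ) (n₀ : ℤ) (η : ℤ → ℝ) (β : ℕ → ℝ)
    (Y : Fin 4 → ℤ → ℝ → ℝ) (W : Fin 3 → ℤ → ℝ → ℝ) (F : ℤ → ℝ → ℝ) (τ₁ μ₁ : ℝ) : Prop where
  /-- (6.67)–(6.81) for the symmetric amplitudes and energies. -/
  base : RescaledConclusion γ ε₀ K ε n₀ Y F τ₁ μ₁
  /-- The profile at the new checkpoint, fresh and dormant shells: `|W_{i,1+m}(τ₁)| ≤ η(m)μ₁`. -/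
  w_abs_le : ∀ (i : Fin 3) (m : ℕ), |W i (1 + m) τ₁| ≤ η m * μ₁
  /-- The profile at the new checkpoint, previous shell: `|W_{i,0}(τ₁)| ≤ η(-1)μ₁`. -/
  w_prev_abs_le : ∀ i : Fin 3, |W i 0 τ₁| ≤ η (-1) * μ₁
  /-- The dormant clocks at the new checkpoint: `b̃_{1+m}(τ₁) ≥ -β(m)μ₁` for `m ≥ 1`. -/
  clock_dormant_ge : ∀ m : ℕ, 1 ≤ m → -(β m * μ₁) ≤ Y 1 (1 + m) τ₁

/-- **The split Proposition 6.5 with `X₃`-coefficient `γ(K)` and profiles `η, β` (which may depend on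
`ε₀, K, ε, n₀`) — the cell's OBLIGATION in the tree's rescaled vocabulary (a predicate, NOT
asserted).** Quantifier prefix of `TaoCascade.rescaledStepWith'` (`C₃` before `K₀`).
[cite: Tao2016AveragedNS, §6.4 Prop. 6.5] -/
def rescaledSplitStepWith (γ : ℝ → ℝ) (η : ℝ → ℝ → ℝ → ℤ → ℤ → ℝ) (β : ℝ → ℝ → ℝ → ℤ → ℕ → ℝ) :
    Prop :=
  ∀ ε₀ : ℝ, 0 < ε₀ → ε₀ < 1 → ∀ C₃ : ℝ, 0 ≤ C₃ →
    ∃ K₀ : ℝ, ∀ K : ℝ, K₀ ≤ K → 0 < K →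
      ∃ e₀ : ℝ, 0 < e₀ ∧ ∀ ε : ℝ, 0 < ε → ε ≤ e₀ →
        ∀ C₁ C₂ : ℝ, 0 ≤ C₁ → 0 ≤ C₂ →
          ∃ N₀ : ℤ, ∀ n₀ : ℤ, N₀ ≤ n₀ → ∀ N : ℤ, n₀ ≤ N →
            ∀ (τ : ℤ → ℝ) (Y : Fin 4 → ℤ → ℝ → ℝ) (W : Fin 3 → ℤ → ℝ → ℝ) (F : ℤ → ℝ → ℝ),
              RescaledSplitHypotheses (γ K) ε₀ K ε C₁ C₂ C₃ n₀ N (η ε₀ K ε n₀) (β ε₀ K ε n₀)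
                  τ Y W F →
                ∃ τ₁ μ₁ : ℝ,
                  RescaledSplitConclusion (γ K) ε₀ K ε n₀ (η ε₀ K ε n₀) (β ε₀ K ε n₀) Y W F τ₁ μ₁

section Unscale

variable {γ ε₀ K ε : ℝ} {n₀ N : ℤ} {X : Fin 4 → ℤ → ℝ → ℝ} {Z : Fin 3 → ℤ → ℝ → ℝ}
  {E : ℤ → ℝ → ℝ} {t e : ℤ → ℝ} {η : ℤ → ℝ} {β : ℕ → ℝ}

/-- **Un-rescaling the profile**: the profile clauses of the rescaled conclusion at `(τ₁, μ₁)` are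
the clauses of `SplitAsymmetryProfile η β` at level `N+1` with `t_{N+1} := t_N + (1+ε₀)^{-5N/2}e_N⁻¹τ₁`,
`e_{N+1} := μ₁e_N`. [cite: Tao2016AveragedNS, §6.4 p. 34] -/
theorem SplitAsymmetryProfile.unscale (heN : 0 < e N) {τ₁ μ₁ : ℝ}
    (hconc : RescaledSplitConclusion γ ε₀ K ε n₀ η β (rescMode ε₀ t e N X) (rescModeZ ε₀ t e N Z)
      (rescEnergy ε₀ t e N E) τ₁ μ₁) :
    SplitAsymmetryProfile η β ε₀ K ε n₀ X Z E (N + 1)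
      (Function.update t (N + 1) (t N + rescScale ε₀ e N * τ₁))
      (Function.update e (N + 1) (e N * μ₁)) := by
  have hc : 0 < (e N)⁻¹ := inv_pos.2 heN
  set lam := rescScale ε₀ e N with hlam_def
  unfold SplitAsymmetryProfile
  simp only [Function.update_self]
  refine ⟨fun i m => ?_, fun _ i => ?_, fun m hm => ?_⟩
  · have h := hconc.w_abs_le i m
    change |(e N)⁻¹ * Z i (N + (1 + m)) (t N + lam * τ₁)| ≤ _ at h
    have e1 : N + (1 + (m : ℤ)) = N + 1 + m := by ring
    rw [e1, abs_mul, abs_of_pos hc, inv_mul_le_iff₀ heN] at h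
    linarith
  · have h := hconc.w_prev_abs_le i
    change |(e N)⁻¹ * Z i (N + 0) (t N + lam * τ₁)| ≤ _ at h
    have e1 : N + 1 - 1 = N + 0 := by ring
    rw [abs_mul, abs_of_pos hc, inv_mul_le_iff₀ heN] at h
    rw [e1]
    linarith
  · have h := hconc.clock_dormant_ge m hm
    change _ ≤ (e N)⁻¹ * X 1 (N + (1 + m)) (t N + lam * τ₁) at h
    have e1 : N + (1 + (m : ℤ)) = N + 1 + m := by ring
    rw [e1, le_inv_mul_iff₀ heN] at h
    linarith

end Unscale

/-! ## Proposition 6.4♯ (and Theorem 6.2♯) from Proposition 6.5♯ -/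

/-- **Prop. 6.5♯_γ(η,β) ⇒ Prop. 6.4♯_γ(`SplitAsymmetryProfile η β`) (PROVED)**: rescale by
(6.82)–(6.84) (`SplitODESystem.rescaledSplitHypotheses` with `C₃ = tauConst ε₀`), apply the rescaled
step, and un-rescale the conclusion (`StateBoundsWith.unscale`, `StepBounds.unscale`,
`SplitAsymmetryProfile.unscale`) with `t_{N+1} := t_N + (1+ε₀)^{-5N/2}e_N⁻¹τ₁`, `e_{N+1} := μ₁e_N`.
[cite: Tao2016AveragedNS, §6.4 p. 59] -/
theorem splitBlowupDynamicsStepWith_of_rescaledSplitStepWith {γ : ℝ → ℝ}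
    {η : ℝ → ℝ → ℝ → ℤ → ℤ → ℝ} {β : ℝ → ℝ → ℝ → ℤ → ℕ → ℝ} (h : rescaledSplitStepWith γ η β) :
    splitBlowupDynamicsStepWith γ fun ε₀ K ε n₀ =>
      SplitAsymmetryProfile (η ε₀ K ε n₀) (β ε₀ K ε n₀) ε₀ K ε n₀ := by
  intro ε₀ hε₀ hε₀1
  obtain ⟨K₀, hK⟩ := h ε₀ hε₀ hε₀1 (tauConst ε₀) (tauConst_nonneg hε₀)
  refine ⟨K₀, fun K hK₀K hKpos => ?_⟩
  obtain ⟨e₀, he₀, hε⟩ := hK K hK₀K hKpos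
  refine ⟨e₀, he₀, fun ε hεpos hεle C₁ C₂ hC₁ hC₂ => ?_⟩
  obtain ⟨N₀, hN⟩ := hε ε hεpos hεle C₁ C₂ hC₁ hC₂
  refine ⟨N₀, fun n₀ hn₀ S Z E hsol N hNn t e hce hP => ?_⟩
  have heN : 0 < e N := hce.amp_pos hNn le_rfl
  have hε₀' : -1 < ε₀ := by linarith
  obtain ⟨τ₁, μ₁, hconc⟩ := hN n₀ hn₀ N hNn (rescTime ε₀ t e N) (rescMode ε₀ t e N S)
    (rescModeZ ε₀ t e N Z) (rescEnergy ε₀ t e N E)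
    (hsol.rescaledSplitHypotheses hce hP hε₀ hNn hC₁ hC₂)
  exact ⟨_, _, (hconc.base.stateBoundsWith hε₀').unscale heN,
    hconc.base.stepBounds.unscale hε₀ heN hconc.base.tau_le, SplitAsymmetryProfile.unscale heN hconc⟩

/-- **Theorem 6.2♯ ⇐ Prop. 6.5♯_γ(η,β)** for `γ, η, β ≥ 0` (PROVED reduction): the split system has no
global solution in Tao's regime once the rescaled split step holds for some admissible coefficient
and profiles. [cite: Tao2016AveragedNS, §6.2–6.4] -/
theorem noGlobalSplit_of_rescaledSplitStepWith {γ : ℝ → ℝ} (hγ : ∀ K, 0 < K → 0 ≤ γ K)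
    {η : ℝ → ℝ → ℝ → ℤ → ℤ → ℝ} {β : ℝ → ℝ → ℝ → ℤ → ℕ → ℝ}
    (hη : ∀ ε₀ K ε n₀ m, 0 ≤ η ε₀ K ε n₀ m) (hβ : ∀ ε₀ K ε n₀ m, 0 ≤ β ε₀ K ε n₀ m)
    (h : rescaledSplitStepWith γ η β) :
    ∀ ε₀ : ℝ, 0 < ε₀ → ε₀ < 1 →
      ∃ K₀ : ℝ, ∀ K : ℝ, K₀ ≤ K → 0 < K →
        ∃ e₀ : ℝ, 0 < e₀ ∧ ∀ ε : ℝ, 0 < ε → ε ≤ e₀ →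
          ∀ C₁ C₂ : ℝ, 0 ≤ C₁ → 0 ≤ C₂ →
            ∃ N₀ : ℤ, ∀ n₀ : ℤ, N₀ ≤ n₀ →
              ¬ ∃ (S : Fin 4 → ℤ → ℝ → ℝ) (Z : Fin 3 → ℤ → ℝ → ℝ) (E : ℤ → ℝ → ℝ),
                SplitODESystem ε₀ K ε C₁ C₂ n₀ S Z E :=
  noGlobalSplit_of_profileStep hγ hη hβ (splitBlowupDynamicsStepWith_of_rescaledSplitStepWith h)

end Literature.Analysis.FluidPDE.Tao2016AveragedNS
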